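import Literature.AnabelianGeometry.EtaleTheta.Discharge.Sec5RigidityOfBiKummerDataGalois
import Literature.AnabelianGeometry.EtaleTheta.Discharge.Sec5Prop55OfPullRootOfBiKummerData
import Literature.AnabelianGeometry.EtaleTheta.Discharge.Sec5CyclotomicRigidityCodOfBiKummerData
import HarnessLib

/-!
# [EtTh] Prop. 5.5 at the assembled §5 data `ofBiKummerData` — P55-L06c via the root's Kummer cocycle, and the varying-codomain
# existence clause — ON THE v2 SUBQUOTIENT RECORD `ThetaSubquotientProjGalois` (surjective at Galois objects only) — PROOF-ONLY

S. Mochizuki, *The étale theta function and its Frobenioid-theoretic manifestations*, Publ. RIMS **45** (2009)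
[cite: MochizukiEtTh2009, Prop 5.5 p.327–328 (PDF pp.101–102); §5 p.331 (PDF p.105); §5 p.327 (PDF p.101) «these subquotients
determine subquotients `Aut_D(D) ↠ Aut^Θ_D(D)`»].
abc-iut cell, layer L2, seat abc-iut-w6-d020 (gen 7), row «(w4-S) V1→V2 PORT — deep EndKnit*/AllLeavesV3*/KummerComparisonInputsLevel*
heads» (abc-iut-L2-lead gen 7 R957; VNEXT-CENSUS-L2 §G5 add. 11 standing row «(w4)»), layer S1b = the remaining Prop. 5.5 heads at the
carrier over abc-iut-w5-d013's (w4-R) carrier file `Sec5RigidityOfBiKummerDataGalois`.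

WHY.  Four more `P`-binding Prop. 5.5 theorems at abc-iut-L2-t4's assembled data bind abc-iut-L2-t4's v1 record `(P : ThetaSubquotientProj 𝔉)`
(surjective at EVERY base object; EMPTY at the root model for `l` odd, p456572 / p476337): abc-iut-w5-d123's `hcup_iff_pull_root_mul`
(P55-L06c ⟺ Galois-equivariance of the bi-Kummer cocycle of the root, `Sec5Prop55SgpCupConjOfBiKummerData`) and
`cyclotomicRigidity_ofBiKummerData_of_pullRoot` (`Sec5Prop55OfPullRootOfBiKummerData`), and abc-iut-w5-d020's varying-codomain
existence bridge `Thm56Sub.rigidityFamily_exists_of_cyclotomicRigidityCod(')` with its carrier instance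
`rigidityFamily_exists_ofBiKummerData_of_cod` (`Sec5CyclotomicRigidityCodOfBiKummerData`; the varying-codomain statement
`Thm56Sub.CyclotomicRigidityCod` itself and `cyclotomicRigidityCod_ofBiKummerData(_roots)` are `P`-FREE and used BY NAME).  abc-iut-w6-d079's
v2 record `ThetaSubquotientProjGalois 𝔉 Gal` (p481123) is INHABITED at every `ofSetting` carrier (p481568) and at every level stub
(p486065); the v2 clauses `ThetaSubquotientProjGalois.IsKummerDetermined` / `.CyclotomicRigidity` and the predicate twins
`EtaTautologicalGal` / `CyclotomeCentralUnderLDeltaGal` (p484491) are the SAME formulas (they read `P` only through `pre` / `proj` at `Base(B_N)`).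

THIS FILE re-keys those five theorems on the v2 record — binder `{Gal : D → Prop} (P : ThetaSubquotientProjGalois 𝔉 Gal)`, statements
otherwise and proofs VERBATIM (`hcup_iff_pull_root_mul` reads only `P.pre`; no `proj_surjective` anywhere), names = originals + `_galois`
(the primed bridge becomes `…_galois'`); twins consumed BY NAME: abc-iut-w5-d013's `cyclotomicRigidity_ofBiKummerData_of_laws_galois`,
`exists_eta_etaTautological_ofBiKummerData_galois`, `unitsCentralUnderLDelta_ofBiKummerData_galois` (p487908 / C2), abc-iut-w6-d079's
`isKummerDetermined_of_thetaPair_gal`, `cyclotomeCentral_of_unitsCentral_gal` (p484491).  0 `def`s; no v1 file edited; the v1 heads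
are the `P.toGalois Gal` instances (`Iff.rfl` bridges `isKummerDetermined_toGalois_iff`, `cyclotomicRigidity_toGalois_iff`).

HONEST FRAMING: a typing repair of the cell's OWN record (weaker quantifier on `P`, as print uses it); kernel-checked implications between
typed statements over abc-iut-L2-t4's assembled §5 data; the structural leaves (`hgal`, `hproj`, `hKR`, `hfrac`, …) stay NAMED exactly as in
the v1 heads; nothing of [EtTh] (refereed) is asserted; typed ≠ discharged; nothing here bears on [IUTchIII] Cor. 3.12 — no side taken;
nothing here asserts abc proved or refuted.
-/

noncomputable section

namespace Literature.AnabelianGeometry.EtaleTheta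

open CategoryTheory Opposite FrobenioidCyclotomicRigidity Literature.AlgebraicGeometry.Frobenioids
open Literature.AlgebraicGeometry.Frobenioids.PreFrobenioid (pull_injective)

universe u₀ v₀ u v w w₁ v₁ v₁' u₁ u₁'

namespace ThetaFrobenioid

/-! ### (1) The bridge (abstract §5 data): existence on `B_N` from the varying-codomain proposition, on the v2 record -/

namespace Thm56Sub

variable {C : Type u₁} [Category.{v₁} C] {D : Type u₁'} [Category.{v₁'} D] {𝔉 : ThetaFrobenioid.{w₁} C D}
  {IsCod : C → Prop} {Gal : D → Prop}

/-- (v2 record `ThetaSubquotientProjGalois`; the v1 theorem `rigidityFamily_exists_of_cyclotomicRigidityCod` VERBATIM — binder type + twin names only.) **Prop. 5.5, existence clause of abc-iut-L2-t4's fixed-codomain statement FROM the varying-codomain one** (p.327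
l.−6 – p.328 l.11): if `CyclotomicRigidityCod 𝔉 hcodSat ν` holds, `B_N` is itself an admissible codomain, and at `B_N` the
bi-Kummer difference cocycle is `ν_{B_N} ∘ η` up to a coboundary (Prop. 5.2 (iii), `ThetaPairKummerClass`) with `η`
tautological on the `Δ`-part (P55-L02) and that part centralising `μ_N(B_N)` (P55-L02b), then there is a rigidity family
that is functorial for linear morphisms, Kummer-determined on `B_N` THROUGH `P` (abc-iut-L2-t4's `IsKummerDetermined`) and
Kummer-determined at every codomain — no reachability FROM `B_N` is used.
[cite: MochizukiEtTh2009, Prop 5.5 p.327–328 (PDF pp.101–102)] -/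
theorem rigidityFamily_exists_of_cyclotomicRigidityCod_galois (hcodSat : ∀ S'', IsCod S'' → 𝔉.IsThetaSaturated S'')
    (ν : NativeIsoFamily 𝔉 IsCod) (hcod : CyclotomicRigidityCod 𝔉 hcodSat ν) (hBcod : IsCod 𝔉.BN)
    (P : ThetaSubquotientProjGalois 𝔉 Gal) {η : 𝔉.HB → 𝔉.lDeltaModN 𝔉.BN}
    (hK : FrobenioidThetaBiKummer.ThetaPairKummerClass 𝔉 η (ν 𝔉.BN hBcod)) (hη : EtaTautologicalGal 𝔉 P η)
    (hc : CyclotomeCentralUnderLDeltaGal 𝔉 P) :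
    ∃ ρ : RigidityFamily 𝔉, ThetaSubquotientProjGalois.IsKummerDetermined (𝔉 := 𝔉) P ρ (hcodSat 𝔉.BN hBcod) ∧ IsFunctorialLinear 𝔉 ρ ∧
      IsKummerDeterminedCod 𝔉 hcodSat ν ρ := by
  obtain ⟨⟨ρ, hKc, hρ⟩, -⟩ := hcod
  exact ⟨ρ, isKummerDetermined_of_thetaPair_gal 𝔉 P hK hη hc ρ (hcodSat 𝔉.BN hBcod) (hKc 𝔉.BN hBcod), hρ, hKc⟩

/-- (v2 record `ThetaSubquotientProjGalois`; the v1 theorem `rigidityFamily_exists_of_cyclotomicRigidityCod'` VERBATIM — binder type + twin names only.) The same with the theta-saturation witness of `B_N` supplied separately (proof-irrelevant rewrite), in the exact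
shape of the existence clause of abc-iut-L2-t4's `ThetaSubquotientProjGalois.CyclotomicRigidity (𝔉 := 𝔉) P hB`.
[cite: MochizukiEtTh2009, Prop 5.5 p.327–328 (PDF pp.101–102)] -/
theorem rigidityFamily_exists_of_cyclotomicRigidityCod_galois' (hcodSat : ∀ S'', IsCod S'' → 𝔉.IsThetaSaturated S'')
    (ν : NativeIsoFamily 𝔉 IsCod) (hcod : CyclotomicRigidityCod 𝔉 hcodSat ν) (hBcod : IsCod 𝔉.BN)
    (hB : 𝔉.IsThetaSaturated 𝔉.BN) (P : ThetaSubquotientProjGalois 𝔉 Gal) {η : 𝔉.HB → 𝔉.lDeltaModN 𝔉.BN}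
    (hK : FrobenioidThetaBiKummer.ThetaPairKummerClass 𝔉 η (ν 𝔉.BN hBcod)) (hη : EtaTautologicalGal 𝔉 P η)
    (hc : CyclotomeCentralUnderLDeltaGal 𝔉 P) :
    ∃ ρ : RigidityFamily 𝔉, ThetaSubquotientProjGalois.IsKummerDetermined (𝔉 := 𝔉) P ρ hB ∧ IsFunctorialLinear 𝔉 ρ ∧
      IsKummerDeterminedCod 𝔉 hcodSat ν ρ :=
  rigidityFamily_exists_of_cyclotomicRigidityCod_galois hcodSat ν hcod hBcod P hK hη hc


end Thm56Sub

/-! ### (2) P55-L06c ⟺ the Galois-equivariance of the bi-Kummer cocycle of the root, on the v2 record -/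

section Kummer

variable {K : Type u₀} [Field K] {X : SemiGraphs.TemperedArithmeticGroup.{u₀} K} {D₀ : Type u₀} [Category.{v₀} D₀]
  {V : FrdIMonoidStub.{w}} {T₀ : RealifiedDivisorMonoids (D₀ := D₀) V} {D : Type u} [Category.{v} D]
  {VD : FrdICatStub.{u, v, w} D} {S : BiKummerSetting X T₀ D VD}
  {pullFrac : ∀ {A A' : S.C} (_ : A' ⟶ A), S.biratUnits A → S.biratUnits A'}
  {lv N : ℕ+} {T : ThetaEnvData.{max v w} N} {θ : S.biratUnits S.Aodot} {Bl : S.C}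
  {Pl : S.FractionPair θ Bl} {Rl : S.NthRoot θ Pl lv pullFrac}
  (h : ModelFrobenioid.Hypotheses S.tf.divisorMonoid S.tf.ratFnFunctor)
  (toB : ∀ A : S.C, S.biratUnits A →* S.tf.biratUnitsModel A) (Q : FrobenioidTheta.ThetaSubquotientStub.{w} D)
  (odd_l : Odd (lv : ℕ)) (R : S.NthRoot Rl.root Rl.pair N pullFrac) (ιX : T.PiX ≃ₜ* X.Pi)
  (hopen : IsOpen ((S.galoisSurj R.AN.base R.αData.isGalois).ker : Set X.Pi)) (σ : Aut R.AN.base →* Aut R.AN)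
  (K' : Type w) [Field K'] (constEmb : K'ˣ →* S.tf.biratUnitsModel R.BN)
  (constEmb_injective : Function.Injective constEmb)
  (hdivc : ∀ g : Aut R.BN.base,
    ModelFrobenioid.div ((σ ((BiKummerSetting.NthRoot.baseIso S R).conjAut.symm g)).hom ≫ R.pair.num) =
      ModelFrobenioid.div R.pair.num)
  (hdivp : ∀ y : T.PiYdd,
    ModelFrobenioid.div ((σ (S.galoisSurj R.AN.base R.αData.isGalois (ιX y.1))).hom ≫ R.pair.den) =
      ModelFrobenioid.div R.pair.den)
  {Gal : D → Prop}

/-- (v2 record `ThetaSubquotientProjGalois`; the v1 theorem `hcup_iff_pull_root_mul` VERBATIM — binder type + twin names only.) **P55-L06c at the assembled §5 data: the structural binder `hcup` of abc-iut-w4-d008's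
`Thm56Sub.cyclotomicRigidity_of_laws_galois` / abc-iut-w5-d020's `cyclotomicRigidity_ofBiKummerData_of_laws_galois` (VERBATIM) is
EQUIVALENT to the Galois-equivariance of the bi-Kummer cocycle of the root over `(l·Δ_Θ)`**, stated in the §4 setting's
vocabulary: for all `y₀ ∈ Π^tp_X̲` and all `y ∈ Π^tp_Ÿ̲` whose image `ρ(y)` lies over `(l·Δ_Θ)_{B_N}` (`∈ P.pre`), with
`g₀ = ρ_{A_N}(ιX y₀)`, `g = ρ_{A_N}(ιX y)` (`S.galoisSurj` at the Galois object `A_N^bs`) and `x ∈ B(A_N^bs)` the rational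
function of the `N`-th root `f_N` (`toB R.AN R.root`): `g^*(g₀^* x) · x = g^* x · g₀^* x` — the Kummer cocycle
`c(γ) = γ^* x / x` is multiplicative at `(g₀, g)`, equivalently `g` fixes `c(g₀)`, equivalently (left action
`γ ⋆ z = (γ⁻¹)^* z`, `κ(γ) = γ ⋆ x / x`) `κ(g₀ g g₀⁻¹) = g₀ ⋆ κ(g)`: "the part of `Π^tp_Ÿ̲` over `l·Δ_Θ` acts compatibly
on the Kummer classes of the root", which print draws from "the detailed description of the étale theta class in
Proposition 1.3" (Prop. 5.5 proof, p.327 (PDF p.101)).  The subquotient datum `P` and the stub `(l·Δ_Θ)_{(−)}` being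
FREE at `ofBiKummerData`, this is where the leaf now sits: one named condition on the setting's Galois action
`S.galoisSurj` and the root `R` (no new `Prop` constant).  Inputs `hσ`, `hfrac` as in abc-iut-L2-t4's
`biKummerDifferenceMem_ofBiKummerData`.  [cite: MochizukiEtTh2009, Prop 5.5 proof p.327–328 (PDF pp.101–102); §5 p.331 (PDF p.105)] -/
theorem hcup_iff_pull_root_mul_galois (hσ : ∀ g : Aut R.AN.base, ModelFrobenioid.baseMap (σ g).hom = g.hom)
    (hfrac : ∀ {A B : S.C} (s' s'' : A ⟶ B) (h' : S.IsPreStep s') (h'' : S.IsPreStep s'')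
      (hb : PreFrobenioid.BaseEquivalent S.F s' s''),
      (toB A (S.fracOf s' s'' h' h'' hb) : S.tf.ratFnFunctor.obj (op A.base)) *
        ModelFrobenioid.unit s'' = ModelFrobenioid.unit s')
    (P : ThetaSubquotientProjGalois (ofBiKummerData h toB Q odd_l R ιX hopen σ K' constEmb constEmb_injective hdivc hdivp) Gal) :
    (∀ (g : Aut ((ofBiKummerData h toB Q odd_l R ιX hopen σ K' constEmb constEmb_injective hdivc hdivp).base.obj (ofBiKummerData h toB Q odd_l R ιX hopen σ K' constEmb constEmb_injective hdivc hdivp).BN)) (k : (ofBiKummerData h toB Q odd_l R ιX hopen σ K' constEmb constEmb_injective hdivc hdivp).HB), (k : Aut ((ofBiKummerData h toB Q odd_l R ιX hopen σ K' constEmb constEmb_injective hdivc hdivp).base.obj (ofBiKummerData h toB Q odd_l R ιX hopen σ K' constEmb constEmb_injective hdivc hdivp).BN)) ∈ P.pre _ →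
        ∃ hmem : g * (k : Aut ((ofBiKummerData h toB Q odd_l R ιX hopen σ K' constEmb constEmb_injective hdivc hdivp).base.obj (ofBiKummerData h toB Q odd_l R ιX hopen σ K' constEmb constEmb_injective hdivc hdivp).BN)) * g⁻¹ ∈ (ofBiKummerData h toB Q odd_l R ιX hopen σ K' constEmb constEmb_injective hdivc hdivp).HB,
          (ofBiKummerData h toB Q odd_l R ιX hopen σ K' constEmb constEmb_injective hdivc hdivp).sgpCup ⟨g * (k : Aut ((ofBiKummerData h toB Q odd_l R ιX hopen σ K' constEmb constEmb_injective hdivc hdivp).base.obj (ofBiKummerData h toB Q odd_l R ιX hopen σ K' constEmb constEmb_injective hdivc hdivp).BN)) * g⁻¹, hmem⟩ = (ofBiKummerData h toB Q odd_l R ιX hopen σ K' constEmb constEmb_injective hdivc hdivp).sgpCap g * (ofBiKummerData h toB Q odd_l R ιX hopen σ K' constEmb constEmb_injective hdivc hdivp).sgpCup k * ((ofBiKummerData h toB Q odd_l R ιX hopen σ K' constEmb constEmb_injective hdivc hdivp).sgpCap g)⁻¹) ↔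
      ∀ (y₀ y : T.PiX), y ∈ T.PiYdd → rhoOfBiKummerData R ιX y ∈ P.pre R.BN.base →
        pull S.tf.ratFnFunctor (S.galoisSurj R.AN.base R.αData.isGalois (ιX y)).hom
            (pull S.tf.ratFnFunctor (S.galoisSurj R.AN.base R.αData.isGalois (ιX y₀)).hom
              (toB R.AN R.root : S.tf.ratFnFunctor.obj (op R.AN.base))) *
            (toB R.AN R.root : S.tf.ratFnFunctor.obj (op R.AN.base)) =
          pull S.tf.ratFnFunctor (S.galoisSurj R.AN.base R.αData.isGalois (ιX y)).hom
              (toB R.AN R.root : S.tf.ratFnFunctor.obj (op R.AN.base)) *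
            pull S.tf.ratFnFunctor (S.galoisSurj R.AN.base R.αData.isGalois (ιX y₀)).hom
              (toB R.AN R.root : S.tf.ratFnFunctor.obj (op R.AN.base)) := by
  constructor
  · intro H y₀ y hy hP
    obtain ⟨hmem, hEq⟩ := H (rhoOfBiKummerData R ιX y₀) ⟨rhoOfBiKummerData R ιX y, Subgroup.mem_map_of_mem _ hy⟩ hP
    exact (sgpCup_conj_eq_iff_pull_root h toB Q odd_l R ιX hopen σ K' constEmb constEmb_injective hdivc hdivp hσ hfrac y₀ y hy ⟨_, hmem⟩ rfl).mp hEq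
  · rintro H g ⟨k, hkHB⟩ hkP
    obtain ⟨y₀, rfl⟩ := rhoOfBiKummerData_surjective R ιX g
    obtain ⟨y, hy, rfl⟩ := Subgroup.mem_map.mp hkHB
    exact ⟨(ofBiKummerData h toB Q odd_l R ιX hopen σ K' constEmb constEmb_injective hdivc hdivp).conj_mem_HB _ ⟨_, hkHB⟩,
      (sgpCup_conj_eq_iff_pull_root h toB Q odd_l R ιX hopen σ K' constEmb constEmb_injective hdivc hdivp hσ hfrac y₀ y hy ⟨_, (ofBiKummerData h toB Q odd_l R ιX hopen σ K' constEmb constEmb_injective hdivc hdivp).conj_mem_HB _ ⟨_, hkHB⟩⟩ rfl).mpr (H y₀ y hy hkP)⟩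


end Kummer

/-! ### (3) Prop. 5.5 with P55-L06c via the root, and the varying-codomain existence clause, at the carrier — v2 record -/

section RD

variable {K : Type u₀} [Field K]
  {X : SemiGraphs.TemperedArithmeticGroup.{u₀} K} {D₀ : Type u₀} [Category.{v₀} D₀]
  {V : FrdIMonoidStub.{w}} {T₀ : RealifiedDivisorMonoids (D₀ := D₀) V} {D : Type u} [Category.{v} D]
  {VD : FrdICatStub.{u, v, w} D} {S : BiKummerSetting X T₀ D VD}
  {pullFrac : ∀ {A A' : S.C} (_ : A' ⟶ A), S.biratUnits A → S.biratUnits A'}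
  {lv N : ℕ+} {l' : ℕ} {RD : RigidData.{max v w} N l'} {θ : S.biratUnits S.Aodot} {Bl : S.C}
  {Pl : S.FractionPair θ Bl} {Rl : S.NthRoot θ Pl lv pullFrac}
  (h : ModelFrobenioid.Hypotheses S.tf.divisorMonoid S.tf.ratFnFunctor)
  (toB : ∀ A : S.C, S.biratUnits A →* S.tf.biratUnitsModel A) (Q : FrobenioidTheta.ThetaSubquotientStub.{w} D)
  (odd_l : Odd (lv : ℕ)) (R : S.NthRoot Rl.root Rl.pair N pullFrac) (ιX : RD.PiX ≃ₜ* X.Pi)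
  (hopen : IsOpen ((S.galoisSurj R.AN.base R.αData.isGalois).ker : Set X.Pi)) (σ : Aut R.AN.base →* Aut R.AN)
  (K' : Type w) [Field K'] (constEmb : K'ˣ →* S.tf.biratUnitsModel R.BN)
  (constEmb_injective : Function.Injective constEmb)
  (hdivc : ∀ g : Aut R.BN.base,
    ModelFrobenioid.div ((σ ((BiKummerSetting.NthRoot.baseIso S R).conjAut.symm g)).hom ≫ R.pair.num) =
      ModelFrobenioid.div R.pair.num)
  (hdivp : ∀ y : RD.PiYdd,
    ModelFrobenioid.div ((σ (S.galoisSurj R.AN.base R.αData.isGalois (ιX y.1))).hom ≫ R.pair.den) =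
      ModelFrobenioid.div R.pair.den)
  {Gal : D → Prop}

/-- (v2 record `ThetaSubquotientProjGalois`; the v1 theorem `cyclotomicRigidity_ofBiKummerData_of_pullRoot` VERBATIM — binder type + twin names only.) **[EtTh] Prop. 5.5 (`ThetaSubquotientProjGalois.CyclotomicRigidity (𝔉 := ofBiKummerData …) P hB`, existence ∧ uniqueness of the rigidity family) for the ASSEMBLED
§5 data, with the structural leaf P55-L06c DISCHARGED modulo the Galois-equivariance (KR) of the bi-Kummer cocycle of the root over
`(l·Δ_Θ)`**: abc-iut-w5-d020's `cyclotomicRigidity_ofBiKummerData_of_laws_galois` with `hcup := (hcup_iff_pull_root_mul_galois … P).mpr hKR`.  Binders: those of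
that theorem verbatim (η-side `hη₀ hdies`, coverage `e he hlift hpre hP`, the Prop. 5.2 (iii) pin `ν hK`, `hσ hgeom hconst hreach hLc hLi`, the
named structural leaves `hgal hproj`), then `hfrac` ([FrdI] Thm. 5.2 (ii) dictionary law of `toB`) and `hKR` in place of `hcup`.
[cite: MochizukiEtTh2009, Prop 5.5 p.327–328 (PDF pp.101–102)] -/
theorem cyclotomicRigidity_ofBiKummerData_of_pullRoot_galois
    (hB : (ofBiKummerData h toB Q odd_l R ιX hopen σ K' constEmb constEmb_injective hdivc hdivp).IsThetaSaturated
      (ofBiKummerData h toB Q odd_l R ιX hopen σ K' constEmb constEmb_injective hdivc hdivp).BN)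
    (P : ThetaSubquotientProjGalois (ofBiKummerData h toB Q odd_l R ιX hopen σ K' constEmb constEmb_injective hdivc hdivp) Gal)
    -- the η-side (abc-iut-w5-d123, P55-L02 at the carrier) and coverage
    {η₀ : RD.PiYdd → RD.mu} (hη₀ : η₀ ∈ RD.thetaCocycles)
    (hdies : ∀ k : RD.PiYdd, rhoOfBiKummerData R ιX k = 1 → η₀ k = 1)
    (e : RD.mu → (ofBiKummerData h toB Q odd_l R ιX hopen σ K' constEmb constEmb_injective hdivc hdivp).lDeltaModN
      (ofBiKummerData h toB Q odd_l R ιX hopen σ K' constEmb constEmb_injective hdivc hdivp).BN)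
    (he : Function.Surjective e)
    (hlift : ∀ a ∈ (ofBiKummerData h toB Q odd_l R ιX hopen σ K' constEmb constEmb_injective hdivc hdivp).HB,
      a ∈ P.pre _ → ∃ k : RD.PiYdd, (k : RD.PiX) ∈ RD.lDeltaTheta ∧ rhoOfBiKummerData R ιX k = a)
    (hpre : ∀ k : RD.PiYdd, (k : RD.PiX) ∈ RD.lDeltaTheta → rhoOfBiKummerData R ιX k ∈ P.pre _)
    (hP : ∀ (k : RD.PiYdd) (hk : (k : RD.PiX) ∈ RD.lDeltaTheta) (hm : rhoOfBiKummerData R ιX k ∈ P.pre _),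
      (QuotientGroup.mk (P.proj _ ⟨rhoOfBiKummerData R ιX k, hm⟩) :
          (ofBiKummerData h toB Q odd_l R ιX hopen σ K' constEmb constEmb_injective hdivc hdivp).lDeltaModN
            (ofBiKummerData h toB Q odd_l R ιX hopen σ K' constEmb constEmb_injective hdivc hdivp).BN) =
        e (RD.thetaMod ⟨k, hk⟩))
    -- the ν-half of the Prop. 5.2 (iii) pin, for the descended η
    (ν : (ofBiKummerData h toB Q odd_l R ιX hopen σ K' constEmb constEmb_injective hdivc hdivp).lDeltaModN
        (ofBiKummerData h toB Q odd_l R ιX hopen σ K' constEmb constEmb_injective hdivc hdivp).BN ≃*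
      (ofBiKummerData h toB Q odd_l R ιX hopen σ K' constEmb constEmb_injective hdivc hdivp).muTorsion
        (ofBiKummerData h toB Q odd_l R ιX hopen σ K' constEmb constEmb_injective hdivc hdivp).BN
        (ofBiKummerData h toB Q odd_l R ιX hopen σ K' constEmb constEmb_injective hdivc hdivp).N)
    (hK : ∀ η : (ofBiKummerData h toB Q odd_l R ιX hopen σ K' constEmb constEmb_injective hdivc hdivp).HB →
        (ofBiKummerData h toB Q odd_l R ιX hopen σ K' constEmb constEmb_injective hdivc hdivp).lDeltaModN
          (ofBiKummerData h toB Q odd_l R ιX hopen σ K' constEmb constEmb_injective hdivc hdivp).BN,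
      (∀ k : RD.PiYdd, η ⟨rhoOfBiKummerData R ιX k, Subgroup.mem_map_of_mem _ k.2⟩ = e (η₀ k)) →
        FrobenioidThetaBiKummer.ThetaPairKummerClass
          (ofBiKummerData h toB Q odd_l R ιX hopen σ K' constEmb constEmb_injective hdivc hdivp) η ν)
    -- centrality of the geometric part (this seat, T56-L09b at the data)
    (hσ : ∀ g : Aut R.AN.base, ModelFrobenioid.baseMap (σ g).hom = g.hom)
    (hgeom : P.pre R.BN.base ≤ RD.aug.ker.map (rhoOfBiKummerData R ιX))
    (hconst : ∀ δ ∈ RD.aug.ker, ∀ τ : ModelFrobenioid.units R.BN,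
      (S.tf.ratFnFunctor.map (rhoOfBiKummerData R ιX δ).hom.op).hom (ModelFrobenioid.unit τ.1.hom) =
        ModelFrobenioid.unit τ.1.hom)
    -- the transport step and its independence, the laws of the free subquotient stub
    (hreach : LinearlyReachableFromBN
      (ofBiKummerData h toB Q odd_l R ιX hopen σ K' constEmb constEmb_injective hdivc hdivp))
    (hLc : Thm56Sub.LDeltaMapComp
      (ofBiKummerData h toB Q odd_l R ιX hopen σ K' constEmb constEmb_injective hdivc hdivp))
    (hLi : Thm56Sub.LDeltaMapId
      (ofBiKummerData h toB Q odd_l R ιX hopen σ K' constEmb constEmb_injective hdivc hdivp))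
    -- the three structural leaves of abc-iut-w4-d008's `cyclotomicRigidity_of_laws_galois` that stay NAMED at the data
    (hgal : ∀ (T : S.C),
      (ofBiKummerData h toB Q odd_l R ιX hopen σ K' constEmb constEmb_injective hdivc hdivp).IsThetaSaturated T →
      ∀ (φ φ' : (ofBiKummerData h toB Q odd_l R ιX hopen σ K' constEmb constEmb_injective hdivc hdivp).BN ⟶ T),
        (ofBiKummerData h toB Q odd_l R ιX hopen σ K' constEmb constEmb_injective hdivc hdivp).IsLinear φ →
        (ofBiKummerData h toB Q odd_l R ιX hopen σ K' constEmb constEmb_injective hdivc hdivp).IsLinear φ' →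
          ∃ g : Aut ((ofBiKummerData h toB Q odd_l R ιX hopen σ K' constEmb constEmb_injective hdivc hdivp).base.obj
              (ofBiKummerData h toB Q odd_l R ιX hopen σ K' constEmb constEmb_injective hdivc hdivp).BN),
            (ofBiKummerData h toB Q odd_l R ιX hopen σ K' constEmb constEmb_injective hdivc hdivp).base.map φ' =
              g.hom ≫ (ofBiKummerData h toB Q odd_l R ιX hopen σ K' constEmb constEmb_injective hdivc hdivp).base.map φ)
    (hproj : ∀ (g g' : Aut ((ofBiKummerData h toB Q odd_l R ιX hopen σ K' constEmb constEmb_injective hdivc hdivp).base.obj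
        (ofBiKummerData h toB Q odd_l R ιX hopen σ K' constEmb constEmb_injective hdivc hdivp).BN))
        (hh : g' ∈ P.pre _), ∃ hgh : g * g' * g⁻¹ ∈ P.pre _,
          (ofBiKummerData h toB Q odd_l R ιX hopen σ K' constEmb constEmb_injective hdivc hdivp).lDeltaMap g.hom
              (P.proj _ ⟨g', hh⟩) = P.proj _ ⟨g * g' * g⁻¹, hgh⟩)
    -- P55-L06c: `hcup` REPLACED by the Galois-equivariance of the bi-Kummer cocycle of the root over `(l·Δ_Θ)`
    (hfrac : ∀ {A B : S.C} (s' s'' : A ⟶ B) (h' : S.IsPreStep s') (h'' : S.IsPreStep s'')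
      (hb : PreFrobenioid.BaseEquivalent S.F s' s''),
      (toB A (S.fracOf s' s'' h' h'' hb) : S.tf.ratFnFunctor.obj (op A.base)) *
        ModelFrobenioid.unit s'' = ModelFrobenioid.unit s')
    (hKR : ∀ (y₀ y : RD.PiX), y ∈ RD.PiYdd → rhoOfBiKummerData R ιX y ∈ P.pre R.BN.base →
        pull S.tf.ratFnFunctor (S.galoisSurj R.AN.base R.αData.isGalois (ιX y)).hom
            (pull S.tf.ratFnFunctor (S.galoisSurj R.AN.base R.αData.isGalois (ιX y₀)).hom
              (toB R.AN R.root : S.tf.ratFnFunctor.obj (op R.AN.base))) *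
            (toB R.AN R.root : S.tf.ratFnFunctor.obj (op R.AN.base)) =
          pull S.tf.ratFnFunctor (S.galoisSurj R.AN.base R.αData.isGalois (ιX y)).hom
              (toB R.AN R.root : S.tf.ratFnFunctor.obj (op R.AN.base)) *
            pull S.tf.ratFnFunctor (S.galoisSurj R.AN.base R.αData.isGalois (ιX y₀)).hom
              (toB R.AN R.root : S.tf.ratFnFunctor.obj (op R.AN.base))) :
    ThetaSubquotientProjGalois.CyclotomicRigidity (𝔉 := ofBiKummerData h toB Q odd_l R ιX hopen σ K' constEmb constEmb_injective hdivc hdivp) P hB :=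
  cyclotomicRigidity_ofBiKummerData_of_laws_galois h toB Q odd_l R ιX hopen σ K' constEmb constEmb_injective hdivc hdivp hB P hη₀ hdies e he hlift hpre hP ν hK hσ hgeom hconst hreach hLc
    hLi hgal hproj ((hcup_iff_pull_root_mul_galois h toB Q odd_l R ιX hopen σ K' constEmb constEmb_injective hdivc hdivp hσ hfrac P).mpr hKR)


/-- (v2 record `ThetaSubquotientProjGalois`; the v1 theorem `rigidityFamily_exists_ofBiKummerData_of_cod` VERBATIM — binder type + twin names only.) **[EtTh] Prop. 5.5 at the ASSEMBLED data — the EXISTENCE clause of abc-iut-L2-t4's `ThetaSubquotientProjGalois.CyclotomicRigidity (𝔉 := ofBiKummerData …) P hB`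
from the varying-codomain proposition**, print-faithfully (no `LinearlyReachableFromBN`): given `CyclotomicRigidityCod`
at the data for an admissible class containing `B_N` (`hBcod`), the η-side of the Prop. 5.2 (iii) pin (abc-iut-w5-d123:
the mod-`N` theta cocycle `η₀` descends along `ρ` — `hdies` — to an `η` tautological on the `Δ`-part, P55-L02) whose
`ν`-half IS the native iso at `B_N` (`hK`), and the centrality of the geometric part (T56-L09b at the data, from `hσ`,
`hgeom`, `hconst`), there is a rigidity family functorial for linear morphisms, Kummer-determined on `B_N` through `P` and
at every codomain.  [cite: MochizukiEtTh2009, Prop 5.5 p.327–328 (PDF pp.101–102)] -/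
theorem rigidityFamily_exists_ofBiKummerData_of_cod_galois {IsCod : S.C → Prop}
    (hcodSat : ∀ S'', IsCod S'' →
      (ofBiKummerData h toB Q odd_l R ιX hopen σ K' constEmb constEmb_injective hdivc hdivp).IsThetaSaturated S'')
    (ν : Thm56Sub.NativeIsoFamily
      (ofBiKummerData h toB Q odd_l R ιX hopen σ K' constEmb constEmb_injective hdivc hdivp) IsCod)
    (hcod : Thm56Sub.CyclotomicRigidityCod
      (ofBiKummerData h toB Q odd_l R ιX hopen σ K' constEmb constEmb_injective hdivc hdivp) hcodSat ν)
    (hBcod : IsCod R.BN)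
    (hB : (ofBiKummerData h toB Q odd_l R ιX hopen σ K' constEmb constEmb_injective hdivc hdivp).IsThetaSaturated
      (ofBiKummerData h toB Q odd_l R ιX hopen σ K' constEmb constEmb_injective hdivc hdivp).BN)
    (P : ThetaSubquotientProjGalois (ofBiKummerData h toB Q odd_l R ιX hopen σ K' constEmb constEmb_injective hdivc hdivp) Gal)
    -- the η-side (abc-iut-w5-d123, P55-L02 at the carrier)
    {η₀ : RD.PiYdd → RD.mu} (hη₀ : η₀ ∈ RD.thetaCocycles)
    (hdies : ∀ k : RD.PiYdd, rhoOfBiKummerData R ιX k = 1 → η₀ k = 1)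
    (e : RD.mu → (ofBiKummerData h toB Q odd_l R ιX hopen σ K' constEmb constEmb_injective hdivc hdivp).lDeltaModN
      (ofBiKummerData h toB Q odd_l R ιX hopen σ K' constEmb constEmb_injective hdivc hdivp).BN)
    (hlift : ∀ a ∈ (ofBiKummerData h toB Q odd_l R ιX hopen σ K' constEmb constEmb_injective hdivc hdivp).HB,
      a ∈ P.pre _ → ∃ k : RD.PiYdd, (k : RD.PiX) ∈ RD.lDeltaTheta ∧ rhoOfBiKummerData R ιX k = a)
    (hP : ∀ (k : RD.PiYdd) (hk : (k : RD.PiX) ∈ RD.lDeltaTheta) (hm : rhoOfBiKummerData R ιX k ∈ P.pre _),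
      (QuotientGroup.mk (P.proj _ ⟨rhoOfBiKummerData R ιX k, hm⟩) :
          (ofBiKummerData h toB Q odd_l R ιX hopen σ K' constEmb constEmb_injective hdivc hdivp).lDeltaModN
            (ofBiKummerData h toB Q odd_l R ιX hopen σ K' constEmb constEmb_injective hdivc hdivp).BN) =
        e (RD.thetaMod ⟨k, hk⟩))
    -- the ν-half of the Prop. 5.2 (iii) pin IS the native iso at `B_N`, for the descended η
    (hK : ∀ η : (ofBiKummerData h toB Q odd_l R ιX hopen σ K' constEmb constEmb_injective hdivc hdivp).HB →
        (ofBiKummerData h toB Q odd_l R ιX hopen σ K' constEmb constEmb_injective hdivc hdivp).lDeltaModN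
          (ofBiKummerData h toB Q odd_l R ιX hopen σ K' constEmb constEmb_injective hdivc hdivp).BN,
      (∀ k : RD.PiYdd, η ⟨rhoOfBiKummerData R ιX k, Subgroup.mem_map_of_mem _ k.2⟩ = e (η₀ k)) →
        FrobenioidThetaBiKummer.ThetaPairKummerClass
          (ofBiKummerData h toB Q odd_l R ιX hopen σ K' constEmb constEmb_injective hdivc hdivp) η (ν R.BN hBcod))
    -- centrality of the geometric part (T56-L09b at the data)
    (hσ : ∀ g : Aut R.AN.base, ModelFrobenioid.baseMap (σ g).hom = g.hom)
    (hgeom : P.pre R.BN.base ≤ RD.aug.ker.map (rhoOfBiKummerData R ιX))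
    (hconst : ∀ δ ∈ RD.aug.ker, ∀ τ : ModelFrobenioid.units R.BN,
      (S.tf.ratFnFunctor.map (rhoOfBiKummerData R ιX δ).hom.op).hom (ModelFrobenioid.unit τ.1.hom) =
        ModelFrobenioid.unit τ.1.hom) :
    ∃ ρ : RigidityFamily (ofBiKummerData h toB Q odd_l R ιX hopen σ K' constEmb constEmb_injective hdivc hdivp),
      ThetaSubquotientProjGalois.IsKummerDetermined (𝔉 := ofBiKummerData h toB Q odd_l R ιX hopen σ K' constEmb constEmb_injective hdivc hdivp) P ρ hB ∧
      IsFunctorialLinear (ofBiKummerData h toB Q odd_l R ιX hopen σ K' constEmb constEmb_injective hdivc hdivp) ρ ∧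
      Thm56Sub.IsKummerDeterminedCod
        (ofBiKummerData h toB Q odd_l R ιX hopen σ K' constEmb constEmb_injective hdivc hdivp) hcodSat ν ρ := by
  -- the descended, tautological η (abc-iut-w5-d123)
  obtain ⟨η, hηdesc, hηtaut⟩ := exists_eta_etaTautological_ofBiKummerData_galois h toB Q odd_l R ιX hopen σ K' constEmb
    constEmb_injective hdivc hdivp hη₀ hdies e P hlift hP
  exact Thm56Sub.rigidityFamily_exists_of_cyclotomicRigidityCod_galois' hcodSat ν hcod hBcod hB P (hK η hηdesc) hηtaut
    (Thm56Sub.cyclotomeCentral_of_unitsCentral_gal _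
      (unitsCentralUnderLDelta_ofBiKummerData_galois h toB Q odd_l R ιX hopen σ K' constEmb constEmb_injective hdivc hdivp
        hσ P hgeom hconst))


end RD

end ThetaFrobenioid

end Literature.AnabelianGeometry.EtaleTheta

end
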